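import Summits.ResolutionOfSingularities.ResolutionOfSingularities.Theorems.FrobeniusClosingSteerHevLeafMax
import Summits.ResolutionOfSingularities.ResolutionOfSingularities.Theorems.FrobeniusClosingSteerWords25ATailOddCore
import Summits.ResolutionOfSingularities.ResolutionOfSingularities.Theorems.FrobeniusClosingSteerMembersPerfectResidue
import Summits.ResolutionOfSingularities.ResolutionOfSingularities.Theorems.FrobeniusClosingSteerBetaSquareVisibility
import HarnessLib

/-!
# Crux `Steer` (stmt-ResolutionOfSingularities-16345), chain W4.1 — E-ROW row 9 (R1): EVEN-TAIL RIGIDITY, THE PROTECTOR SHAPE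
# `σ·τ·c²` of an exact even binary residue — words (R1-loc′)/(R1), the member-local algebra PROVED, and (R1) PROVED

OURS (campaign `res-hironaka`, rung L ★L-G4, slot W4.1; hand res-L0-w44-stub-3 g14 from the W4.4 reserve, res-L0-w41-plan-1 RULING
258 (d) «E-ROW row 9 (R1) KERNEL OBJECT»).  WORDS = res-L0-w41-idea-2 g13 `L/res-L0-w41-idea-2/g13/Sketch-hev-rigidity-v1_1.lean`
525d070a6c7cb9c7 §1/§2/§2b/§5 (statement author idea-2): `EvenResidueSqFormAt`, `mul_mul_sq_mem_span_pair_pow`,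
`binaryResiduePointStepAt_of_evenResidueSqFormAt`, (R1) `EvenResidueSqFormTwoN`, `eventually_evenResidueSqFormAt_of_R1` are
BYTE-IDENTICAL to v1.1; **(R1-loc) is REPAIRED to (R1-loc′)**: v1.1's `EvenResidueSqFormLocal` quantified over ARBITRARY `σ τ : S` and is
FALSE as typed (witness `S = 𝔽₂[ε]/(ε²)`, `σ = τ = 1`, `e = 1`, `f = ε`, `g = 0`: the hypothesis `f − g² ∈ (σ,τ)² ⊔ 𝔪³ = ⊤` and the
exactness `∀ h, ε − h² ∉ 𝔪³ = 0` hold, but `ε = (g'+c)²` has no solution); the memo's hand proof and the only consumer (the plumbing,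
which holds `IsRsopPart ![σ, τ]`) use `σ, τ ∈ 𝔪`, so (R1-loc′) inserts `σ ∈ maximalIdeal S → τ ∈ maximalIdeal S →` after `1 ≤ e →`
(weaken-only for (R1)) — ADOPTED by idea-2 as words v1.2 `g13/Sketch-hev-rigidity-v1_2.lean` 0f27a225a87339b2 (same name; idea-2 found the
same flaw independently, witness `k⟦x⟧`, `σ = τ = 1`); the plumbing `evenResidueSqFormTwoN_of_local` is idea-2's with the two memberships
discharged by the tree's `IsRsopPart.mem_maximalIdeal`.  Namespace `…HevLeaf.EvenResidueSqForm` = idea-2's tree-ready candidate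
`g13/FILE-R1-EvenResidueSqForm-candidate.lean` 4ee9243c1daf1489 (an INDEPENDENT kernel proof of the same two theorems by parity classes and
`Submodule.pow_induction_on_right'`; this file's proof is the hand's, by `Nat.le_induction` on `e` — the word-level declarations agree).

PROVED HERE (kernel, this hand): `exists_sqForm_of_mem_sq` / `exists_sqForm_of_mem_pow` — over a local ring of characteristic 2 with
perfect residue field, every `w ∈ (σ,τ)^(2e)` (`1 ≤ e`) is `q² + σ·τ·c² + m` with `q ∈ (σ,τ)^e`, `c ∈ (σ,τ)^(e−1)`, `m ∈ 𝔪·(σ,τ)^(2e)`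
(induction on `e`: coefficients are squares mod `𝔪` by the tree's `BetaNewton.exists_sq_sub_mem_maximalIdeal`; sums are free in
characteristic 2; the step is `(q₁² + στc₁²)(q₂² + στc₂²) = (q₁q₂ + στc₁c₂)² + στ(q₁c₂ + c₁q₂)²`); hence **`evenResidueSqFormLocal_holds :
EvenResidueSqFormLocal`** (take `g' = g + q`; `c ∉ 𝔪^e` by exactness) and **`evenResidueSqFormTwoN_holds : EvenResidueSqFormTwoN`** —
(R1) E-SHAPE IS A THEOREM.  `--supports stmt-ResolutionOfSingularities-16345 --as helper`.  Replaces the role of NOTHING in the manuscript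
under review [claim: Hironaka2017, status: under-review]; the campaign's OWN words; nothing is attributed to its author; nothing is a
Literature fact; AI-authored and AI-checked only — weaker than expert review.
-/

set_option linter.dupNamespace false

open IsLocalRing
open Literature.AlgebraicGeometry.Resolution
open Summit.ResolutionOfSingularities.ResolutionOfSingularities.Theorems.SwitchingDichotomy.Words
open Summit.ResolutionOfSingularities.ResolutionOfSingularities.Theorems.SteerRankThinness (Concl HasProperCoarsening)
open Summit.ResolutionOfSingularities.ResolutionOfSingularities.Theorems.SwitchingDichotomy.ArithReduction

namespace Summit.ResolutionOfSingularities.ResolutionOfSingularities.Theorems.SwitchingDichotomy.HevLeaf.EvenResidueSqForm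

variable {K : Type} [Field K]

/-! ## §1 The shape word and its glue to `BinaryResiduePointStepAt` (idea-2 v1.1 §1, verbatim) -/

/-- **`EvenResidueSqFormAt R P s p e i`** — at the POINT step `i` the radicand `s i ^ p ∈ R i` has a cleaning `g`, an rsop pair `(σ, τ)` and a
PROTECTOR `c ∈ (σ,τ)^(e−1) ∖ 𝔪ᵢ^e` with `s i ^ p − g ^ p − σ·τ·c² ∈ 𝔪ᵢ^(2e+1)`, and no cleaning in `𝔪ᵢ^(2e+1)` (exact order `2e`). Reading in
`gr(R i) = κᵢ[x̄,ȳ,σ̄,τ̄]`: the initial form of the cleaned radicand is `σ̄·τ̄·C̄(σ̄,τ̄)²` with `C̄ = in(c) ≠ 0` binary of degree `e − 1`. Every booked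
(MAX) inhabitant has it: W-data `zu·φ²`, N-family `στ(σ+τ)²`, the τ-trinomial `τσ^(2e−1) = στ(σ^(e−1))²`, `F_{a,b}`: `σ³τ = στ·σ²`.
(res-L0-w41-idea-2 v1.1, verbatim.) OURS. (folklore) -/
def EvenResidueSqFormAt (R : ℕ → Subring K) (P : (i : ℕ) → Ideal (R i)) (s : ℕ → K) (p e i : ℕ) : Prop :=
  IsPointStep R P i ∧
    ∃ (_ : IsLocalRing (R i)) (hs : s i ^ p ∈ R i) (g σ τ c : R i), IsRsopPart ![σ, τ] ∧
      c ∈ Ideal.span {σ, τ} ^ (e - 1) ∧ c ∉ maximalIdeal (R i) ^ e ∧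
      (⟨s i ^ p, hs⟩ : R i) - g ^ p - σ * τ * c ^ 2 ∈ maximalIdeal (R i) ^ (2 * e + 1) ∧
      ∀ h : R i, (⟨s i ^ p, hs⟩ : R i) - h ^ p ∉ maximalIdeal (R i) ^ (2 * e + 1)

/-- `σ · τ · c ^ 2 ∈ (σ, τ) ^ (2e)` for `c ∈ (σ, τ) ^ (e − 1)`, `1 ≤ e`. (idea-2 v1.1, verbatim.) [folklore] -/
theorem mul_mul_sq_mem_span_pair_pow {S : Type} [CommRing S] (σ τ c : S) (e : ℕ) (he : 1 ≤ e)
    (hc : c ∈ Ideal.span {σ, τ} ^ (e - 1)) : σ * τ * c ^ 2 ∈ Ideal.span {σ, τ} ^ (2 * e) := by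
  have hσ : σ ∈ Ideal.span {σ, τ} := Ideal.subset_span (by simp)
  have hτ : τ ∈ Ideal.span {σ, τ} := Ideal.subset_span (by simp)
  have h1 : σ * τ ∈ Ideal.span {σ, τ} ^ 2 := by
    rw [pow_two]; exact Ideal.mul_mem_mul hσ hτ
  have h2 : c ^ 2 ∈ Ideal.span {σ, τ} ^ (2 * (e - 1)) := by
    rw [pow_two, two_mul, pow_add]; exact Ideal.mul_mem_mul hc hc
  have h3 : σ * τ * c ^ 2 ∈ Ideal.span {σ, τ} ^ (2 + 2 * (e - 1)) := by
    rw [pow_add]; exact Ideal.mul_mem_mul h1 h2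
  have heq : 2 + 2 * (e - 1) = 2 * e := by omega
  rw [heq] at h3
  exact h3

/-- **PROVED glue**: the shape word refines the run word `BinaryResiduePointStepAt … (2e)` (`1 ≤ e`). (idea-2 v1.1, verbatim.) [folklore] -/
theorem binaryResiduePointStepAt_of_evenResidueSqFormAt (R : ℕ → Subring K) (P : (i : ℕ) → Ideal (R i)) (s : ℕ → K)
    (p e i : ℕ) (he : 1 ≤ e) (h : EvenResidueSqFormAt R P s p e i) : BinaryResiduePointStepAt R P s p (2 * e) i := by
  obtain ⟨hpt, hL, hs, g, σ, τ, c, hrsop, hc, -, hform, hexact⟩ := h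
  refine ⟨hpt, hL, hs, g, σ, τ, hrsop, ?_, hexact⟩
  have hsplit : (⟨s i ^ p, hs⟩ : R i) - g ^ p = σ * τ * c ^ 2 + ((⟨s i ^ p, hs⟩ : R i) - g ^ p - σ * τ * c ^ 2) := by ring
  rw [hsplit]
  exact Ideal.add_mem _ (Ideal.mem_sup_left (mul_mul_sq_mem_span_pair_pow σ τ c e he hc)) (Ideal.mem_sup_right hform)

/-! ## §2 (R1) E-SHAPE (idea-2 v1.1 §2, verbatim) -/

/-- **(R1) `EvenResidueSqFormTwoN`** — E-SHAPE: along a σ_top-steered rank-one run of the datum (p = 2, n = 4, PERFECT ground field, so every member has a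
perfect residue field, `MembersPerfectResidue.perfectField_residueField_member`), every exact even binary residue point step (`BinaryResiduePointStepAt …
(2e)`, `1 ≤ e`) has the protector shape `EvenResidueSqFormAt … e`. PROOF BY HAND (memo §2): in `gr_{2e} = κᵢ[σ̄,τ̄]_{2e}` split the binary initial form of
the cleaned radicand into its even–even monomials `E` and the rest; `E = q̄²` because κᵢ is perfect and p = 2; replacing the cleaner `g` by `g + q`
(`q` a lift of `q̄` in `(σ,τ)^e`) removes `E`; exactness of the order `2e` says the rest is non-zero, and a monomial `σ̄^j τ̄^k` with `j + k = 2e`, not both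
even, has `j`, `k` odd: the rest is `σ̄τ̄·Σ a_{jk} σ̄^(j−1) τ̄^(k−1) = σ̄τ̄·C̄²`.  PROVED below (`evenResidueSqFormTwoN_holds`).
(res-L0-w41-idea-2 v1.1, verbatim.) OURS. (folklore) -/
def EvenResidueSqFormTwoN : Prop :=
  ∀ p : ℕ, p = 2 →
    ∀ (k K : Type) [Field k] [CharP k p] [PerfectField k] [Field K] [Algebra k K]
    (O : ValuationSubring K) (A₀ : Subalgebra k K) (h₀ : A₀.toSubring ≤ O.toSubring) (t : K),
    CoreDatum p 4 k K O A₀ h₀ t → ¬ HasProperCoarsening O →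
    ∀ (R : ℕ → Subring K) (P : (i : ℕ) → Ideal (R i)) (s : ℕ → K),
      R 0 = locAtCentre A₀.toSubring O → NormalAt O (R 0) p t → IsSteeredRun O R P t p s →
      ∀ e i : ℕ, 1 ≤ e → BinaryResiduePointStepAt R P s p (2 * e) i → EvenResidueSqFormAt R P s p e i

/-! ## §2b (R1-loc′) the member-local algebra of E-SHAPE — REPAIRED word (σ, τ ∈ 𝔪) -/

/-- **(R1-loc′) `EvenResidueSqFormLocal`** — the COMMUTATIVE-ALGEBRA content of (R1), over ANY local ring `S` of characteristic 2 with PERFECT residue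
field (regularity not needed), for `σ, τ ∈ 𝔪` (REPAIR of idea-2 v1.1 l.120–127, which omitted `σ, τ ∈ 𝔪` and is false for `σ = τ = 1` in `𝔽₂[ε]/(ε²)`,
`e = 1`, `f = ε`, `g = 0`; the consumer `evenResidueSqFormTwoN_of_local` has `IsRsopPart ![σ, τ]`, hence `σ, τ ∈ 𝔪`): if
`f − g² ∈ (σ,τ)^(2e) + 𝔪^(2e+1)` and no `h` has `f − h² ∈ 𝔪^(2e+1)` (`1 ≤ e`), then `f − g'² − σ·τ·c² ∈ 𝔪^(2e+1)` for some cleaner `g'` and some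
`c ∈ (σ,τ)^(e−1) ∖ 𝔪^e`. PROOF (memo §2, v1.2; kernel below `evenResidueSqFormLocal_holds`): write the `(σ,τ)^(2e)`-part as `Σ_{j+k=2e} a_{jk} σ^j τ^k`;
each `a_{jk} = b_{jk}² + m_{jk}` with `m_{jk} ∈ 𝔪` (perfect residue field); `j + k` even ⇒ (even, even) or (odd, odd); the even–even part is `q²`
(Frobenius additive), the odd–odd part is `στ·c²`; take `g' = g + q`; `c ∉ 𝔪^e` by exactness. OURS. (folklore) -/
def EvenResidueSqFormLocal : Prop :=
  ∀ (S : Type) [CommRing S] [IsLocalRing S] [CharP S 2], PerfectField (ResidueField S) →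
    ∀ (f g σ τ : S) (e : ℕ), 1 ≤ e → σ ∈ maximalIdeal S → τ ∈ maximalIdeal S →
      f - g ^ 2 ∈ Ideal.span {σ, τ} ^ (2 * e) ⊔ maximalIdeal S ^ (2 * e + 1) →
      (∀ h : S, f - h ^ 2 ∉ maximalIdeal S ^ (2 * e + 1)) →
      ∃ g' c : S, c ∈ Ideal.span {σ, τ} ^ (e - 1) ∧ c ∉ maximalIdeal S ^ e ∧
        f - g' ^ 2 - σ * τ * c ^ 2 ∈ maximalIdeal S ^ (2 * e + 1)

/-! ## §2c The kernel algebra: square forms of `(σ,τ)^(2e)` in characteristic 2 over a perfect residue field -/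

section LocalAlgebra

variable {S : Type} [CommRing S]

/-- **Degree two.**  Over a local ring of characteristic `2` with perfect residue field: every `w ∈ (σ,τ)²` is `q² + σ·τ·c² + m` with
`q ∈ (σ,τ)` and `m ∈ 𝔪·(σ,τ)²` (for `x = aσ + bτ`, `y = a'σ + b'τ`: `xy = aa'σ² + (ab' + ba')στ + bb'τ²`, each coefficient a square
modulo `𝔪`, `BetaNewton.exists_sq_sub_mem_maximalIdeal`; sums are free since `(u + v)² = u² + v²`). OURS. [folklore] -/
theorem exists_sqForm_of_mem_sq [IsLocalRing S] [CharP S 2] (hperf : PerfectField (ResidueField S)) (σ τ : S) {w : S}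
    (hw : w ∈ Ideal.span {σ, τ} ^ 2) :
    ∃ q c m : S, q ∈ Ideal.span {σ, τ} ∧ m ∈ maximalIdeal S * Ideal.span {σ, τ} ^ 2 ∧
      w = q ^ 2 + σ * τ * c ^ 2 + m := by
  have h2 : (2 : S) = 0 := CharTwo.two_eq_zero
  have hσ : σ ∈ Ideal.span {σ, τ} := Ideal.subset_span (by simp)
  have hτ : τ ∈ Ideal.span {σ, τ} := Ideal.subset_span (by simp)
  have hσ2 : σ ^ 2 ∈ Ideal.span {σ, τ} ^ 2 := Ideal.pow_mem_pow hσ 2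
  have hτ2 : τ ^ 2 ∈ Ideal.span {σ, τ} ^ 2 := Ideal.pow_mem_pow hτ 2
  have hστ : σ * τ ∈ Ideal.span {σ, τ} ^ 2 := by
    rw [pow_two]; exact Ideal.mul_mem_mul hσ hτ
  have neg : ∀ {u ξ : S}, ξ ^ 2 - u ∈ maximalIdeal S → u - ξ ^ 2 ∈ maximalIdeal S := fun h => by
    rw [← neg_sub]; exact (maximalIdeal S).neg_mem h
  rw [pow_two] at hw
  refine Submodule.mul_induction_on hw ?_ ?_
  · intro x hx y hy
    obtain ⟨a, b, rfl⟩ := Ideal.mem_span_pair.mp hx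
    obtain ⟨a', b', rfl⟩ := Ideal.mem_span_pair.mp hy
    obtain ⟨ξα, hα⟩ := BetaNewton.exists_sq_sub_mem_maximalIdeal hperf (a * a')
    obtain ⟨ξβ, hβ⟩ := BetaNewton.exists_sq_sub_mem_maximalIdeal hperf (a * b' + b * a')
    obtain ⟨ξγ, hγ⟩ := BetaNewton.exists_sq_sub_mem_maximalIdeal hperf (b * b')
    refine ⟨ξα * σ + ξγ * τ, ξβ,
      (a * a' - ξα ^ 2) * σ ^ 2 + (a * b' + b * a' - ξβ ^ 2) * (σ * τ) + (b * b' - ξγ ^ 2) * τ ^ 2,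
      Ideal.mem_span_pair.mpr ⟨ξα, ξγ, rfl⟩, ?_, ?_⟩
    · exact Ideal.add_mem _ (Ideal.add_mem _ (Ideal.mul_mem_mul (neg hα) hσ2) (Ideal.mul_mem_mul (neg hβ) hστ))
        (Ideal.mul_mem_mul (neg hγ) hτ2)
    · linear_combination (-(ξα * ξγ * σ * τ)) * h2
  · rintro x y ⟨qx, cx, mx, hqx, hmx, hx⟩ ⟨qy, cy, my, hqy, hmy, hy⟩
    refine ⟨qx + qy, cx + cy, mx + my, Ideal.add_mem _ hqx hqy, ?_, ?_⟩
    · exact Ideal.add_mem _ hmx hmy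
    · rw [hx, hy, CharTwo.add_sq, CharTwo.add_sq]; ring

/-- **Degree `2e` (`1 ≤ e`), by induction.**  Over a local ring of characteristic `2` with perfect residue field: every `w ∈ (σ,τ)^(2e)` is
`q² + σ·τ·c² + m` with `q ∈ (σ,τ)^e`, `c ∈ (σ,τ)^(e−1)`, `m ∈ 𝔪·(σ,τ)^(2e)`.  Step `(σ,τ)^(2e+2) = (σ,τ)²·(σ,τ)^(2e)`:
`(q₁² + στc₁² + m₁)(q₂² + στc₂² + m₂) = (q₁q₂ + στc₁c₂)² + στ(q₁c₂ + c₁q₂)² + [(q₁² + στc₁²)m₂ + m₁·y]` in characteristic 2. OURS. [folklore] -/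
theorem exists_sqForm_of_mem_pow [IsLocalRing S] [CharP S 2] (hperf : PerfectField (ResidueField S)) (σ τ : S) {e : ℕ}
    (he : 1 ≤ e) {w : S} (hw : w ∈ Ideal.span {σ, τ} ^ (2 * e)) :
    ∃ q c m : S, q ∈ Ideal.span {σ, τ} ^ e ∧ c ∈ Ideal.span {σ, τ} ^ (e - 1) ∧
      m ∈ maximalIdeal S * Ideal.span {σ, τ} ^ (2 * e) ∧ w = q ^ 2 + σ * τ * c ^ 2 + m := by
  have h2 : (2 : S) = 0 := CharTwo.two_eq_zero
  set I : Ideal S := Ideal.span {σ, τ} with hI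
  have hσ : σ ∈ I := Ideal.subset_span (by simp)
  have hτ : τ ∈ I := Ideal.subset_span (by simp)
  have hστ : σ * τ ∈ I ^ 2 := by
    rw [pow_two]; exact Ideal.mul_mem_mul hσ hτ
  induction e, he using Nat.le_induction generalizing w with
  | base =>
    have hw' : w ∈ I ^ 2 := by simpa using hw
    obtain ⟨q, c, m, hq, hm, hwq⟩ := exists_sqForm_of_mem_sq hperf σ τ hw'
    refine ⟨q, c, m, by simpa using hq, by simp, by simpa using hm, hwq⟩
  | succ e he ih =>
    have hsplit : I ^ (2 * (e + 1)) = I ^ 2 * I ^ (2 * e) := by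
      rw [← pow_add]; congr 1; ring
    rw [hsplit] at hw
    refine Submodule.mul_induction_on hw ?_ ?_
    · intro x hx y hy
      obtain ⟨qx, cx, mx, hqx, hmx, hx'⟩ := exists_sqForm_of_mem_sq hperf σ τ hx
      obtain ⟨qy, cy, my, hqy, hcy, hmy, hy'⟩ := ih hy
      refine ⟨qx * qy + σ * τ * (cx * cy), qx * cy + cx * qy, (qx ^ 2 + σ * τ * cx ^ 2) * my + mx * y, ?_, ?_, ?_, ?_⟩
      · -- `q ∈ I ^ (e + 1)`
        refine Ideal.add_mem _ ?_ ?_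
        · rw [pow_succ']; exact Ideal.mul_mem_mul hqx hqy
        · have hcc : cx * cy ∈ I ^ (e - 1) := Ideal.mul_mem_left _ _ hcy
          have h := Ideal.mul_mem_mul hστ hcc
          rw [← pow_add, show 2 + (e - 1) = e + 1 by omega] at h
          exact h
      · -- `c ∈ I ^ (e + 1 - 1)`
        rw [Nat.add_sub_cancel]
        refine Ideal.add_mem _ ?_ (Ideal.mul_mem_left _ _ hqy)
        have h := Ideal.mul_mem_mul hqx hcy
        rw [← pow_succ', show e - 1 + 1 = e by omega] at h
        exact h
      · -- `m ∈ 𝔪 * I ^ (2 * (e + 1))`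
        have hX : qx ^ 2 + σ * τ * cx ^ 2 ∈ I ^ 2 :=
          Ideal.add_mem _ (Ideal.pow_mem_pow hqx 2) (Ideal.mul_mem_right _ _ hστ)
        refine Ideal.add_mem _ ?_ ?_
        · have h := Ideal.mul_mem_mul hX hmy
          rw [mul_left_comm, ← hsplit] at h
          exact h
        · have h := Ideal.mul_mem_mul hmx hy
          rw [mul_assoc, ← hsplit] at h
          exact h
      · -- the identity, in characteristic 2
        rw [hx', hy']
        linear_combination (-2 * σ * τ * qx * qy * cx * cy) * h2
    · rintro x y ⟨qx, cx, mx, hqx, hcx, hmx, hx⟩ ⟨qy, cy, my, hqy, hcy, hmy, hy⟩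
      refine ⟨qx + qy, cx + cy, mx + my, Ideal.add_mem _ hqx hqy, Ideal.add_mem _ hcx hcy, ?_, ?_⟩
      · exact Ideal.add_mem _ hmx hmy
      · rw [hx, hy, CharTwo.add_sq, CharTwo.add_sq]; ring

/-- `𝔪 · (σ,τ)^(2e) ⊆ 𝔪^(2e+1)` when `σ, τ ∈ 𝔪`. [folklore] -/
theorem maximalIdeal_mul_span_pair_pow_le [IsLocalRing S] {σ τ : S} (hσ : σ ∈ maximalIdeal S) (hτ : τ ∈ maximalIdeal S)
    (n : ℕ) : maximalIdeal S * Ideal.span {σ, τ} ^ n ≤ maximalIdeal S ^ (n + 1) := by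
  have hI : Ideal.span {σ, τ} ≤ maximalIdeal S := by
    rw [Ideal.span_le]
    rintro x (rfl | rfl)
    · exact hσ
    · exact hτ
  rw [pow_succ']
  exact Ideal.mul_mono_right (Ideal.pow_right_mono hI n)

end LocalAlgebra

/-- **(R1-loc′) IS A THEOREM.**  From `exists_sqForm_of_mem_pow`: with `f − g² = w + r`, `w = q² + στc² + m ∈ (σ,τ)^(2e)`, `r ∈ 𝔪^(2e+1)`,
take `g' = g + q` (so `f − g'² − στc² = m + r ∈ 𝔪^(2e+1)` in characteristic 2); if `c ∈ 𝔪^e` then `στc² ∈ 𝔪^(2e+2)` and `f − g'² ∈ 𝔪^(2e+1)`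
would contradict exactness. OURS. [folklore] -/
theorem evenResidueSqFormLocal_holds : EvenResidueSqFormLocal := by
  intro S _ _ _ hperf f g σ τ e he hσ hτ hfg hexact
  obtain ⟨w, hw, r, hr, hwr⟩ := Submodule.mem_sup.mp hfg
  obtain ⟨q, c, m, -, hc, hm, hwq⟩ := exists_sqForm_of_mem_pow hperf σ τ he hw
  have hm' : m ∈ maximalIdeal S ^ (2 * e + 1) := maximalIdeal_mul_span_pair_pow_le hσ hτ (2 * e) hm
  have key : f - (g + q) ^ 2 - σ * τ * c ^ 2 = m + r := by
    rw [CharTwo.add_sq]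
    linear_combination hwq - hwr
  refine ⟨g + q, c, hc, fun hce => hexact (g + q) ?_, by rw [key]; exact Ideal.add_mem _ hm' hr⟩
  -- `c ∈ 𝔪^e` would make `g + q` a cleaning to order `2e + 1`
  have hστc : σ * τ * c ^ 2 ∈ maximalIdeal S ^ (2 * e + 1) := by
    have h1 : σ * τ ∈ maximalIdeal S ^ 2 := by
      rw [pow_two]; exact Ideal.mul_mem_mul hσ hτ
    have h2 : c ^ 2 ∈ maximalIdeal S ^ (2 * e) := by
      rw [mul_comm 2 e, pow_mul]; exact Ideal.pow_mem_pow hce 2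
    have h3 := Ideal.mul_mem_mul h1 h2
    rw [← pow_add] at h3
    exact Ideal.pow_le_pow_right (by omega) h3
  have : f - (g + q) ^ 2 = σ * τ * c ^ 2 + (m + r) := by rw [← key]; ring
  rw [this]
  exact Ideal.add_mem _ hστc (Ideal.add_mem _ hm' hr)

/-! ## §2d The plumbing (R1-loc′) ⇒ (R1) (idea-2 v1.1, with `σ, τ ∈ 𝔪` discharged from `IsRsopPart`), and (R1) PROVED -/

/-- **PROVED plumbing**: (R1-loc′) ⇒ (R1). The member `R i` of a steered run from a core datum has characteristic 2 (`CharP.subring` from `CharP K 2`)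
and a perfect residue field (`steeredRebase_member_of_eternal` + `MembersPerfectResidue.perfectField_residueField_member`, exactly as in strat-1ʼs
`MaxVacuity.memberFrobeniusCongruence_two`); the rsop letters lie in `𝔪` (`IsRsopPart.mem_maximalIdeal`). (idea-2 v1.1 + two discharges.) [folklore] -/
theorem evenResidueSqFormTwoN_of_local (hloc : EvenResidueSqFormLocal) : EvenResidueSqFormTwoN := by
  intro p hp k K _ _ _ _ _ O A₀ h₀ t core hrk R P s hR0 hN hrun e i he hres
  subst hp
  obtain ⟨hpt, hL, hs, g, σ, τ, hrsop, hmem, hexact⟩ := hres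
  haveI := hL
  haveI : Fact (Nat.Prime 2) := ⟨Nat.prime_two⟩
  haveI : CharP K 2 := charP_of_injective_algebraMap (algebraMap k K).injective 2
  haveI : CharP (R i) 2 := inferInstance
  have hzd : ZeroDim k O := by
    obtain ⟨-, -, -, -, -, hzd, -⟩ := core
    exact hzd
  obtain ⟨A', h', hle, hRN, -, -⟩ :=
    steeredRebase_member_of_eternal 2 Nat.prime_two 4 k K O A₀ h₀ t core R P s hR0 hrun i
  have hRO : R i ≤ O.toSubring := hRN ▸ locAtCentre_le h'
  have hA : A₀.toSubring ≤ R i := fun x hx => hRN ▸ le_locAtCentre _ O (hle hx)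
  haveI : PerfectField (ResidueField (R i)) :=
    MembersPerfectResidue.perfectField_residueField_member O A₀ R i hA hRO hzd
  have hσ : σ ∈ maximalIdeal (R i) := by simpa using hrsop.mem_maximalIdeal 0
  have hτ : τ ∈ maximalIdeal (R i) := by simpa using hrsop.mem_maximalIdeal 1
  obtain ⟨g', c, hc, hce, hform⟩ := hloc (R i) ‹_› ⟨s i ^ 2, hs⟩ g σ τ e he hσ hτ hmem hexact
  exact ⟨hpt, hL, hs, g', σ, τ, c, hrsop, hc, hce, hform, hexact⟩

/-- **(R1) E-SHAPE IS A THEOREM** (E-ROW row 9 (R1), RULING 258 (d)): every exact even binary residue point step of a steered run (p = 2, n = 4,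
perfect ground field) has the protector shape. OURS. [folklore] -/
theorem evenResidueSqFormTwoN_holds : EvenResidueSqFormTwoN :=
  evenResidueSqFormTwoN_of_local evenResidueSqFormLocal_holds

/-! ## §5 The eventual form fed by the (MAX)ᴵ binders (pure logic; idea-2 v1.1 §5, verbatim) and its unconditional corollary -/

/-- From (R1): under the (MAX)ᴵ residue binder `∃ i₀ e, 2 ≤ e ∧ ∀ i ≥ i₀, IsPointStep → BinaryResiduePointStepAt … (2e) i` every late point step has the
protector shape with the SAME `e`. Pure logic. (idea-2 v1.1, verbatim.) [folklore] -/
theorem eventually_evenResidueSqFormAt_of_R1 (hR1 : EvenResidueSqFormTwoN)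
    (p : ℕ) (hp : p = 2) (k K : Type) [Field k] [CharP k p] [PerfectField k] [Field K] [Algebra k K]
    (O : ValuationSubring K) (A₀ : Subalgebra k K) (h₀ : A₀.toSubring ≤ O.toSubring) (t : K)
    (core : CoreDatum p 4 k K O A₀ h₀ t) (hrk : ¬ HasProperCoarsening O)
    (R : ℕ → Subring K) (P : (i : ℕ) → Ideal (R i)) (s : ℕ → K)
    (hR0 : R 0 = locAtCentre A₀.toSubring O) (hN : NormalAt O (R 0) p t) (hrun : IsSteeredRun O R P t p s)
    (hres : ∃ i₀ e : ℕ, 2 ≤ e ∧ ∀ i, i₀ ≤ i → IsPointStep R P i → BinaryResiduePointStepAt R P s p (2 * e) i) :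
    ∃ i₀ e : ℕ, 2 ≤ e ∧ ∀ i, i₀ ≤ i → IsPointStep R P i → EvenResidueSqFormAt R P s p e i := by
  obtain ⟨i₀, e, he, h⟩ := hres
  exact ⟨i₀, e, he, fun i hi hpt =>
    hR1 p hp k K O A₀ h₀ t core hrk R P s hR0 hN hrun e i (by omega) (h i hi hpt)⟩

/-- The same, UNCONDITIONALLY ((R1) proved). OURS. [folklore] -/
theorem eventually_evenResidueSqFormAt
    (p : ℕ) (hp : p = 2) (k K : Type) [Field k] [CharP k p] [PerfectField k] [Field K] [Algebra k K]
    (O : ValuationSubring K) (A₀ : Subalgebra k K) (h₀ : A₀.toSubring ≤ O.toSubring) (t : K)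
    (core : CoreDatum p 4 k K O A₀ h₀ t) (hrk : ¬ HasProperCoarsening O)
    (R : ℕ → Subring K) (P : (i : ℕ) → Ideal (R i)) (s : ℕ → K)
    (hR0 : R 0 = locAtCentre A₀.toSubring O) (hN : NormalAt O (R 0) p t) (hrun : IsSteeredRun O R P t p s)
    (hres : ∃ i₀ e : ℕ, 2 ≤ e ∧ ∀ i, i₀ ≤ i → IsPointStep R P i → BinaryResiduePointStepAt R P s p (2 * e) i) :
    ∃ i₀ e : ℕ, 2 ≤ e ∧ ∀ i, i₀ ≤ i → IsPointStep R P i → EvenResidueSqFormAt R P s p e i :=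
  eventually_evenResidueSqFormAt_of_R1 evenResidueSqFormTwoN_holds p hp k K O A₀ h₀ t core hrk R P s hR0 hN hrun hres

end Summit.ResolutionOfSingularities.ResolutionOfSingularities.Theorems.SwitchingDichotomy.HevLeaf.EvenResidueSqForm
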